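/-
Copyright (c) 2026 the pub-hodgecm-mathlib formalisation cell (harness21).  Prover seat hodgecm-mathlib-K2Liu-p08 (g2), Track B «K2-LIT»,
#184♮ = hLiu418 = `stmt-HodgeConjecture-24832`; K2E5-plan (g6) CO-DEAL 2026-09-04T07:39:22Z «§G1 RESIDUAL» = G1-END (LEAD F0P6-plan (g12) 07:37:26Z (a)),
census `K2/K2Liu-p08/g2/CENSUS-G1END-ResidueLieDerivativeStandard.K2Liu-p08-g2.md` (q1).  Third of the G1-END files: the package algebra
(«`continuation_reclear ∕ continuation_add_polyMul`» of the co-deal), split off the END file `K2LiuResidueLieDerivativeStandard` for size.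
-/
import Summits.HodgeConjecture.HodgeConjecture.Theorems.K2LiuFirstTermResidueForm          -- ★ U0: `resNorm`, `resNorm_add` (U0.4); ★ #9 via its imports
import Summits.HodgeConjecture.HodgeConjecture.Theorems.K2LiuArchOneParameterOrbitHeight   -- ★ `exists_pos_height_mul_le` (height algebra)
import Literature.NumberTheory.LFunctions.SelbergDelangeTheoremProofs                     -- ★ `rpow_le_mul_rpow_of_exponent_le` (floor ⇒ power comparison)
import HarnessLib

/-!
# Crux `HLiu418`, Road I v3, organ G1 (END) — PACKAGE ALGEBRA: re-clearing and combining two pole-cleared continuations with a holomorphic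
# coefficient, and the residue form of the combination

Cell `hodgecm-mathlib`, crux item hLiu418 = `stmt-HodgeConjecture-24832`; co-dealer K2E5-plan (g6) (SIGS-RoadI-v3 §7 G1), LEAD F0P6-plan (g12).
THEOREMS ONLY (no `def`, no instance, no notation, no named-fact hypothesis, no `sorry`); lane `--supports stmt-HodgeConjecture-24832 --as helper`
(count-neutral).  Consumers: the END file `K2LiuResidueLieDerivativeStandard` (G1-END), U5 ∕ Hol (same bookkeeping for their derived families).

THE MATHEMATICS.  Socket #41 delivers, for a family `f`, a PACKAGE `(P, E⋆)`: a finite `P ⊂ ℂ` and `E⋆ : ℂ → H(𝔸) → ℂ` with (i) holomorphy on `{0 < re}`,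
(ii) continuity in `h`, (iv) `E⋆ = ∏_{p∈P}(s − p)·E^Δ(f_s)` on `{n/2 < re}`, (v) locally uniform moderate growth `‖E⋆(s,h)‖ ≤ C‖h‖^A`.  For the DERIVED
family `f′ = f₁ + a·f₂` (`a` entire; in G1-END `a(s) = 2(s − s₀)`, ★ `K2LiuFlatSectionLieDerivative.hasDerivAt_stdExtension_orbit`) one needs a package
too, and ★ U0.4 (`resNorm_finset_sum ∕ _add ∕ _smul`) only COMPARES packages with constant coefficients.  Here:
* §1 a universal height floor `‖x‖ ≥ c₀ > 0` on `H(𝔸)` (`‖1‖ = ‖x x⁻¹‖ ≤ C‖x‖‖x⁻¹‖ = C‖x‖²`; ★ `exists_pos_height_mul_le`, ★ `adelicHeightGL_inv`,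
  ★ `adelicHeightGL_pos_holds`), whence two bounds `Cᵢ‖x‖^{Aᵢ}` merge into one `C‖x‖^{max Aᵢ}` (`growth_add_mul`, ★ `rpow_le_mul_rpow_of_exponent_le`);
* §2 **`continuation_add_mul_{differentiableOn, continuous, eq, growth}`**: `P′ := P₁ ∪ P₂`,
  `E′ := (∏_{P₂∖P₁}(s − p))·E₁ + a(s)·(∏_{P₁∖P₂}(s − p))·E₂` satisfies (i)(ii)(iv)(v) for `f′ = f₁ + a·f₂` ((iv): re-clearing
  `∏_{P₁}·∏_{P₂∖P₁} = ∏_{P₁∪P₂}` + linearity of the CONVERGENT series, ★ #9), and **`resNorm_continuation_add_mul`**: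
  `resNorm P′ E′ = resNorm P₁ E₁ + a(½)·resNorm P₂ E₂` (★ U0.4 `resNorm_add` with the package `(P₂, a·E₂)` of `a·f₂`, then `resNorm_scalar_mul`) —
  at `a(s) = 2(s − ½)` the second residue form DIES (the sheet's `resNorm_halfShift_smul_eq_zero`).
[MoeglinWaldspurger1995, IV.1.9] [KudlaRallis1994, §1 Thm. 1.1] [Liu2021, Lem. B.12 pp. 103–104] [Tan1999, §1] [BorelJacquet1979, §1.2].
HONEST LABEL.  Count-neutral helper; `HC_CM` is proved only modulo the 7 printed citations (2 remaining named inputs: hLiu418 =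
`stmt-HodgeConjecture-24832`, h413 = `stmt-HodgeConjecture-24833`) until rung 0 closes.
-/

set_option autoImplicit false
set_option linter.dupNamespace false -- the mandated namespace repeats `HodgeConjecture.HodgeConjecture`
set_option Elab.async false

noncomputable section

open NumberField NumberField.mixedEmbedding IsDedekindDomain Filter Metric Set Complex
open scoped Topology BigOperators

namespace Summit.HodgeConjecture.HodgeConjecture.Cruxes.HLiu418.K2LiuContinuationPackageAlgebra

open Literature.NumberTheory.Automorphic Literature.NumberTheory.Automorphic.UnitaryGroup
open Literature.NumberTheory.GaloisRepresentations
open Literature.NumberTheory.GelbartRogawski1991 Literature.NumberTheory.GelbartRogawski1991.GRConstruction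
open Literature.NumberTheory.K2Lit.SiegelDoubled
open Summit.HodgeConjecture.HodgeConjecture.Cruxes.HLiu418.K2LiuFirstTermResidueFormDefs
open Summit.HodgeConjecture.HodgeConjecture.Cruxes.HLiu418.K2LiuFirstTermResidueForm
open Summit.HodgeConjecture.HodgeConjecture.Cruxes.HLiu418.K2LiuSiegelEisensteinDoubledSummable (siegelEisensteinDoubledSummable)
open Summit.HodgeConjecture.HodgeConjecture.Cruxes.HLiu418.K2LiuArchOneParameterOrbitHeight (exists_pos_height_mul_le)
open Literature.NumberTheory.LFunctions.SelbergDelange (rpow_le_mul_rpow_of_exponent_le)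

section Frame

variable (L : Type) [Field L] [NumberField L] [IsCMField L]
variable {N M n : ℕ} (e : Fin N × Fin M ≃ Fin n)
  (dV : Fin N → L) (hdV : ∀ i, IsCMField.complexConj L (dV i) = dV i) (hdV0 : ∀ i, dV i ≠ 0)
  (dW : Fin M → L) (hdW : ∀ i, IsCMField.complexConj L (dW i) = dW i) (hdW0 : ∀ i, dW i ≠ 0)

/-! ## §1 A universal floor for the adelic height on `H(𝔸)`; merging two moderate-growth bounds -/

/-- **height floor**: for `n ≥ 1` there is `c₀ > 0` with `c₀ ≤ ‖x‖` for every `x ∈ H(𝔸)` (`‖1‖ = ‖x·x⁻¹‖ ≤ C‖x‖‖x⁻¹‖ = C‖x‖²`).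
[cite: BorelJacquet1979, §1.2 (properties (i), (ii))] -/
theorem exists_height_floor (hn : 0 < n) :
    ∃ c₀ : ℝ, 0 < c₀ ∧ ∀ x : HA L e dV hdV dW hdW, c₀ ≤ adelicHeightGL (n + n) L (x : GL (Fin (n + n)) (AdeleRing (𝓞 L) L)) := by
  haveI : NeZero (n + n) := ⟨by omega⟩
  obtain ⟨C, hC0, hC⟩ := exists_pos_height_mul_le (n := n + n) (K := L)
  have h1 : 0 < adelicHeightGL (n + n) L (1 : GL (Fin (n + n)) (AdeleRing (𝓞 L) L)) := adelicHeightGL_pos_holds 1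
  refine ⟨Real.sqrt (adelicHeightGL (n + n) L (1 : GL (Fin (n + n)) (AdeleRing (𝓞 L) L)) / C), Real.sqrt_pos.2 (div_pos h1 hC0),
    fun x => ?_⟩
  set a : ℝ := adelicHeightGL (n + n) L (x : GL (Fin (n + n)) (AdeleRing (𝓞 L) L)) with ha
  have ha0 : 0 ≤ a := adelicHeightGL_nonneg _
  have h2 := (hC (x : GL (Fin (n + n)) (AdeleRing (𝓞 L) L)) ((x : GL (Fin (n + n)) (AdeleRing (𝓞 L) L))⁻¹)).1
  rw [mul_inv_cancel, adelicHeightGL_inv, ← ha] at h2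
  have h3 : adelicHeightGL (n + n) L (1 : GL (Fin (n + n)) (AdeleRing (𝓞 L) L)) / C ≤ a ^ 2 := by
    rw [div_le_iff₀ hC0]
    nlinarith
  calc Real.sqrt (adelicHeightGL (n + n) L (1 : GL (Fin (n + n)) (AdeleRing (𝓞 L) L)) / C) ≤ Real.sqrt (a ^ 2) := Real.sqrt_le_sqrt h3
    _ = a := Real.sqrt_sq ha0

/-- near a point a continuous scalar is bounded by its value plus one. [folklore] -/
theorem exists_ball_norm_le_of_continuous {a : ℂ → ℂ} (ha : Continuous a) (z : ℂ) :
    ∃ δ : ℝ, 0 < δ ∧ ∀ s : ℂ, dist s z < δ → ‖a s‖ ≤ ‖a z‖ + 1 := by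
  obtain ⟨δ, hδ, hd⟩ := Metric.continuousAt_iff.1 ha.continuousAt 1 one_pos
  refine ⟨δ, hδ, fun s hs => ?_⟩
  have h1 : dist (a s) (a z) < 1 := hd hs
  rw [dist_eq_norm] at h1
  calc ‖a s‖ = ‖a z + (a s - a z)‖ := by rw [add_sub_cancel]
    _ ≤ ‖a z‖ + ‖a s - a z‖ := norm_add_le _ _
    _ ≤ ‖a z‖ + 1 := by linarith

/-- **merging two moderate-growth clauses (v)**: if `E₁`, `E₂` satisfy socket #41's clause (v) and `a₁`, `a₂ : ℂ → ℂ` are continuous, then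
`a₁(s)E₁(s,h) + a₂(s)E₂(s,h)` satisfies (v) (exponent `max A₁ A₂`, thanks to the height floor). [cite: MoeglinWaldspurger1995, IV.1.9] [cite: BorelJacquet1979, §1.2] -/
theorem growth_add_mul (hn : 0 < n) {E₁ E₂ : ℂ → HA L e dV hdV dW hdW → ℂ} {a₁ a₂ : ℂ → ℂ} (ha₁ : Continuous a₁) (ha₂ : Continuous a₂)
    (hv₁ : ∀ z : ℂ, 0 < z.re → ∃ C A r : ℝ, 0 < r ∧ ∀ s : ℂ, dist s z < r → ∀ h : HA L e dV hdV dW hdW,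
      ‖E₁ s h‖ ≤ C * adelicHeightGL (n + n) L (h : GL (Fin (n + n)) (AdeleRing (𝓞 L) L)) ^ A)
    (hv₂ : ∀ z : ℂ, 0 < z.re → ∃ C A r : ℝ, 0 < r ∧ ∀ s : ℂ, dist s z < r → ∀ h : HA L e dV hdV dW hdW,
      ‖E₂ s h‖ ≤ C * adelicHeightGL (n + n) L (h : GL (Fin (n + n)) (AdeleRing (𝓞 L) L)) ^ A) :
    ∀ z : ℂ, 0 < z.re → ∃ C A r : ℝ, 0 < r ∧ ∀ s : ℂ, dist s z < r → ∀ h : HA L e dV hdV dW hdW,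
      ‖a₁ s * E₁ s h + a₂ s * E₂ s h‖ ≤ C * adelicHeightGL (n + n) L (h : GL (Fin (n + n)) (AdeleRing (𝓞 L) L)) ^ A := by
  intro z hz
  obtain ⟨c₀, hc₀, hfloor⟩ := exists_height_floor L e dV hdV dW hdW hn
  obtain ⟨C₁, A₁, r₁, hr₁, hb₁⟩ := hv₁ z hz
  obtain ⟨C₂, A₂, r₂, hr₂, hb₂⟩ := hv₂ z hz
  obtain ⟨δ₁, hδ₁, hd₁⟩ := exists_ball_norm_le_of_continuous ha₁ z
  obtain ⟨δ₂, hδ₂, hd₂⟩ := exists_ball_norm_le_of_continuous ha₂ z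
  set A : ℝ := max A₁ A₂ with hAdef
  refine ⟨(‖a₁ z‖ + 1) * (max C₁ 0 * c₀ ^ (A₁ - A)) + (‖a₂ z‖ + 1) * (max C₂ 0 * c₀ ^ (A₂ - A)), A,
    min (min r₁ r₂) (min δ₁ δ₂), lt_min (lt_min hr₁ hr₂) (lt_min hδ₁ hδ₂), fun s hs h => ?_⟩
  have hs₁ : dist s z < r₁ := lt_of_lt_of_le hs ((min_le_left _ _).trans (min_le_left _ _))
  have hs₂ : dist s z < r₂ := lt_of_lt_of_le hs ((min_le_left _ _).trans (min_le_right _ _))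
  have hsδ₁ : dist s z < δ₁ := lt_of_lt_of_le hs ((min_le_right _ _).trans (min_le_left _ _))
  have hsδ₂ : dist s z < δ₂ := lt_of_lt_of_le hs ((min_le_right _ _).trans (min_le_right _ _))
  set x : ℝ := adelicHeightGL (n + n) L (h : GL (Fin (n + n)) (AdeleRing (𝓞 L) L)) with hxdef
  have hx : c₀ ≤ x := hfloor h
  have hxpos : 0 < x := lt_of_lt_of_le hc₀ hx
  have hE₁ : ‖E₁ s h‖ ≤ max C₁ 0 * c₀ ^ (A₁ - A) * x ^ A :=
    calc ‖E₁ s h‖ ≤ C₁ * x ^ A₁ := hb₁ s hs₁ h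
      _ ≤ max C₁ 0 * x ^ A₁ := mul_le_mul_of_nonneg_right (le_max_left _ _) (Real.rpow_nonneg hxpos.le _)
      _ ≤ max C₁ 0 * (c₀ ^ (A₁ - A) * x ^ A) :=
        mul_le_mul_of_nonneg_left (rpow_le_mul_rpow_of_exponent_le hc₀ hx (le_max_left _ _)) (le_max_right _ _)
      _ = max C₁ 0 * c₀ ^ (A₁ - A) * x ^ A := by ring
  have hE₂ : ‖E₂ s h‖ ≤ max C₂ 0 * c₀ ^ (A₂ - A) * x ^ A :=
    calc ‖E₂ s h‖ ≤ C₂ * x ^ A₂ := hb₂ s hs₂ h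
      _ ≤ max C₂ 0 * x ^ A₂ := mul_le_mul_of_nonneg_right (le_max_left _ _) (Real.rpow_nonneg hxpos.le _)
      _ ≤ max C₂ 0 * (c₀ ^ (A₂ - A) * x ^ A) :=
        mul_le_mul_of_nonneg_left (rpow_le_mul_rpow_of_exponent_le hc₀ hx (le_max_right _ _)) (le_max_right _ _)
      _ = max C₂ 0 * c₀ ^ (A₂ - A) * x ^ A := by ring
  have hK₁ : 0 ≤ max C₁ 0 * c₀ ^ (A₁ - A) * x ^ A :=
    mul_nonneg (mul_nonneg (le_max_right _ _) (Real.rpow_nonneg hc₀.le _)) (Real.rpow_nonneg hxpos.le _)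
  have hK₂ : 0 ≤ max C₂ 0 * c₀ ^ (A₂ - A) * x ^ A :=
    mul_nonneg (mul_nonneg (le_max_right _ _) (Real.rpow_nonneg hc₀.le _)) (Real.rpow_nonneg hxpos.le _)
  calc ‖a₁ s * E₁ s h + a₂ s * E₂ s h‖ ≤ ‖a₁ s‖ * ‖E₁ s h‖ + ‖a₂ s‖ * ‖E₂ s h‖ := by
        refine (norm_add_le _ _).trans ?_
        rw [norm_mul, norm_mul]
    _ ≤ (‖a₁ z‖ + 1) * (max C₁ 0 * c₀ ^ (A₁ - A) * x ^ A) + (‖a₂ z‖ + 1) * (max C₂ 0 * c₀ ^ (A₂ - A) * x ^ A) :=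
        add_le_add (mul_le_mul (hd₁ s hsδ₁) hE₁ (norm_nonneg _) (by positivity))
          (mul_le_mul (hd₂ s hsδ₂) hE₂ (norm_nonneg _) (by positivity))
    _ = ((‖a₁ z‖ + 1) * (max C₁ 0 * c₀ ^ (A₁ - A)) + (‖a₂ z‖ + 1) * (max C₂ 0 * c₀ ^ (A₂ - A))) * x ^ A := by ring

/-! ## §2 Package algebra: re-clearing and combining two continuations with a holomorphic coefficient -/

include hdV0 hdW0 in
/-- linearity of the CONVERGENT Eisenstein series at a fixed `s` with `Re s > n/2`: `E^Δ(g₁ + c·g₂) = E^Δ(g₁) + c·E^Δ(g₂)` for continuous sections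
`g₁, g₂ ∈ I(s, χ)`, `χ` unitary (★ #9 summability). [cite: Tan1999, §1] [cite: KudlaRallis1994, §1] -/
theorem eisensteinSeriesDelta_add_mul {χ : HeckeCharacter L} (hχ : χ.IsUnitary) {s : ℂ} (hs : (n : ℝ) / 2 < s.re)
    {g₁ g₂ : HA L e dV hdV dW hdW → ℂ} (hg₁ : IsSiegelDeltaSection L e dV hdV dW hdW χ s g₁) (hg₁c : Continuous g₁)
    (hg₂ : IsSiegelDeltaSection L e dV hdV dW hdW χ s g₂) (hg₂c : Continuous g₂) (c : ℂ) (h : HA L e dV hdV dW hdW) :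
    eisensteinSeriesDelta L e dV hdV dW hdW (fun x => g₁ x + c * g₂ x) h =
      eisensteinSeriesDelta L e dV hdV dW hdW g₁ h + c * eisensteinSeriesDelta L e dV hdV dW hdW g₂ h := by
  have h₁ := (siegelEisensteinDoubledSummable L e dV hdV hdV0 dW hdW hdW0 χ hχ s hs g₁ hg₁ hg₁c h).of_norm
  have h₂ := (siegelEisensteinDoubledSummable L e dV hdV hdV0 dW hdW hdW0 χ hχ s hs g₂ hg₂ hg₂c h).of_norm
  simp only [eisensteinSeriesDelta]
  rw [h₁.tsum_add (h₂.mul_left c), tsum_mul_left]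

/-- the Eisenstein series of `c·g` is `c·E^Δ(g)` (no convergence needed). [cite: Tan1999, §1] -/
theorem eisensteinSeriesDelta_const_mul (c : ℂ) (g : HA L e dV hdV dW hdW → ℂ) (h : HA L e dV hdV dW hdW) :
    eisensteinSeriesDelta L e dV hdV dW hdW (fun x => c * g x) h = c * eisensteinSeriesDelta L e dV hdV dW hdW g h := by
  simp only [eisensteinSeriesDelta]
  rw [tsum_mul_left]

/-- re-clearing: `∏_{P₁}·∏_{P₂∖P₁} = ∏_{P₁∪P₂}`. [folklore] -/
theorem prod_mul_prod_sdiff_eq_prod_union (P₁ P₂ : Finset ℂ) (s : ℂ) :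
    (∏ p ∈ P₁, (s - p)) * ∏ p ∈ P₂ \ P₁, (s - p) = ∏ p ∈ P₁ ∪ P₂, (s - p) := by
  rw [← Finset.prod_union Finset.disjoint_sdiff, Finset.union_sdiff_self_eq_union]

section Packages

variable {χ : HeckeCharacter L} {f₁ f₂ : ℂ → HA L e dV hdV dW hdW → ℂ} {a : ℂ → ℂ}
  {P₁ : Finset ℂ} {E₁ : ℂ → HA L e dV hdV dW hdW → ℂ} {P₂ : Finset ℂ} {E₂ : ℂ → HA L e dV hdV dW hdW → ℂ}

/-- **combined package, clause (i)**: holomorphy on `{0 < re}` of `E′ = (∏_{P₂∖P₁}(s−p))E₁ + a(s)(∏_{P₁∖P₂}(s−p))E₂` for holomorphic `a`.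
[cite: MoeglinWaldspurger1995, IV.1.9] -/
theorem continuation_add_mul_differentiableOn (ha : Differentiable ℂ a)
    (hd₁ : ∀ h : HA L e dV hdV dW hdW, DifferentiableOn ℂ (fun s => E₁ s h) {s : ℂ | 0 < s.re})
    (hd₂ : ∀ h : HA L e dV hdV dW hdW, DifferentiableOn ℂ (fun s => E₂ s h) {s : ℂ | 0 < s.re}) (h : HA L e dV hdV dW hdW) :
    DifferentiableOn ℂ (fun s => (∏ p ∈ P₂ \ P₁, (s - p)) * E₁ s h + a s * (∏ p ∈ P₁ \ P₂, (s - p)) * E₂ s h) {s : ℂ | 0 < s.re} := by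
  have hQ : ∀ Q : Finset ℂ, DifferentiableOn ℂ (fun s : ℂ => ∏ p ∈ Q, (s - p)) {s : ℂ | 0 < s.re} := fun Q =>
    DifferentiableOn.fun_finsetProd fun p _ => differentiableOn_id.sub (differentiableOn_const _)
  exact ((hQ _).mul (hd₁ h)).add ((ha.differentiableOn.mul (hQ _)).mul (hd₂ h))

/-- **combined package, clause (ii)**: continuity in `h`. [cite: MoeglinWaldspurger1995, IV.1.9] -/
theorem continuation_add_mul_continuous
    (hii₁ : ∀ s : ℂ, 0 < s.re → Continuous (E₁ s)) (hii₂ : ∀ s : ℂ, 0 < s.re → Continuous (E₂ s)) (s : ℂ) (hs : 0 < s.re) :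
    Continuous fun h : HA L e dV hdV dW hdW => (∏ p ∈ P₂ \ P₁, (s - p)) * E₁ s h + a s * (∏ p ∈ P₁ \ P₂, (s - p)) * E₂ s h :=
  (continuous_const.mul (hii₁ s hs)).add (continuous_const.mul (hii₂ s hs))

include hdV0 hdW0 in
/-- **combined package, clause (iv)**: on `{n/2 < re}`, `E′ = ∏_{P₁∪P₂}(s − p)·E^Δ((f₁ + a·f₂)_s)` (re-clearing + ★ #9 linearity; `χ` unitary, `f₁ s`,
`f₂ s` continuous sections). [cite: MoeglinWaldspurger1995, IV.1.9] [cite: KudlaRallis1994, §1 Thm. 1.1] -/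
theorem continuation_add_mul_eq (hχ : χ.IsUnitary)
    (hf₁ : ∀ s, IsSiegelDeltaSection L e dV hdV dW hdW χ s (f₁ s)) (hf₁c : ∀ s, Continuous (f₁ s))
    (hf₂ : ∀ s, IsSiegelDeltaSection L e dV hdV dW hdW χ s (f₂ s)) (hf₂c : ∀ s, Continuous (f₂ s))
    (hiv₁ : ∀ (s : ℂ) (h : HA L e dV hdV dW hdW), (n : ℝ) / 2 < s.re →
      E₁ s h = (∏ p ∈ P₁, (s - p)) * eisensteinFamilyDelta L e dV hdV dW hdW f₁ s h)
    (hiv₂ : ∀ (s : ℂ) (h : HA L e dV hdV dW hdW), (n : ℝ) / 2 < s.re →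
      E₂ s h = (∏ p ∈ P₂, (s - p)) * eisensteinFamilyDelta L e dV hdV dW hdW f₂ s h)
    (s : ℂ) (h : HA L e dV hdV dW hdW) (hs : (n : ℝ) / 2 < s.re) :
    (∏ p ∈ P₂ \ P₁, (s - p)) * E₁ s h + a s * (∏ p ∈ P₁ \ P₂, (s - p)) * E₂ s h =
      (∏ p ∈ P₁ ∪ P₂, (s - p)) * eisensteinFamilyDelta L e dV hdV dW hdW (fun s h => f₁ s h + a s * f₂ s h) s h := by
  have hlin : eisensteinFamilyDelta L e dV hdV dW hdW (fun s h => f₁ s h + a s * f₂ s h) s h =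
      eisensteinFamilyDelta L e dV hdV dW hdW f₁ s h + a s * eisensteinFamilyDelta L e dV hdV dW hdW f₂ s h := by
    simp only [eisensteinFamilyDelta]
    exact eisensteinSeriesDelta_add_mul L e dV hdV hdV0 dW hdW hdW0 hχ hs (hf₁ s) (hf₁c s) (hf₂ s) (hf₂c s) (a s) h
  rw [hlin, hiv₁ s h hs, hiv₂ s h hs, mul_add]
  have h12 : (∏ p ∈ P₂ \ P₁, (s - p)) * ((∏ p ∈ P₁, (s - p)) * eisensteinFamilyDelta L e dV hdV dW hdW f₁ s h) =
      (∏ p ∈ P₁ ∪ P₂, (s - p)) * eisensteinFamilyDelta L e dV hdV dW hdW f₁ s h := by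
    rw [← mul_assoc, mul_comm (∏ p ∈ P₂ \ P₁, (s - p)), prod_mul_prod_sdiff_eq_prod_union]
  have h21 : a s * (∏ p ∈ P₁ \ P₂, (s - p)) * ((∏ p ∈ P₂, (s - p)) * eisensteinFamilyDelta L e dV hdV dW hdW f₂ s h) =
      (∏ p ∈ P₁ ∪ P₂, (s - p)) * (a s * eisensteinFamilyDelta L e dV hdV dW hdW f₂ s h) := by
    rw [Finset.union_comm, ← prod_mul_prod_sdiff_eq_prod_union P₂ P₁ s]
    ring
  rw [h12, h21]

/-- **combined package, clause (v)**: moderate growth, locally uniformly in `s` (§1 `growth_add_mul` with the polynomial coefficients; `n ≥ 1`).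
[cite: MoeglinWaldspurger1995, IV.1.9] [cite: BorelJacquet1979, §1.2] -/
theorem continuation_add_mul_growth (hn : 0 < n) (ha : Continuous a)
    (hv₁ : ∀ z : ℂ, 0 < z.re → ∃ C A r : ℝ, 0 < r ∧ ∀ s : ℂ, dist s z < r → ∀ h : HA L e dV hdV dW hdW,
      ‖E₁ s h‖ ≤ C * adelicHeightGL (n + n) L (h : GL (Fin (n + n)) (AdeleRing (𝓞 L) L)) ^ A)
    (hv₂ : ∀ z : ℂ, 0 < z.re → ∃ C A r : ℝ, 0 < r ∧ ∀ s : ℂ, dist s z < r → ∀ h : HA L e dV hdV dW hdW,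
      ‖E₂ s h‖ ≤ C * adelicHeightGL (n + n) L (h : GL (Fin (n + n)) (AdeleRing (𝓞 L) L)) ^ A) :
    ∀ z : ℂ, 0 < z.re → ∃ C A r : ℝ, 0 < r ∧ ∀ s : ℂ, dist s z < r → ∀ h : HA L e dV hdV dW hdW,
      ‖(∏ p ∈ P₂ \ P₁, (s - p)) * E₁ s h + a s * (∏ p ∈ P₁ \ P₂, (s - p)) * E₂ s h‖ ≤
        C * adelicHeightGL (n + n) L (h : GL (Fin (n + n)) (AdeleRing (𝓞 L) L)) ^ A := by
  have hQ : ∀ Q : Finset ℂ, Continuous fun s : ℂ => ∏ p ∈ Q, (s - p) := fun Q =>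
    continuous_finsetProd Q fun p _ => continuous_id.sub continuous_const
  exact growth_add_mul L e dV hdV dW hdW hn (hQ _) (ha.mul (hQ _)) hv₁ hv₂

/-- the residue form of a package rescaled by a scalar function `a(s)`: `resNorm P (a·E) = a(½)·resNorm P E`. [cite: KudlaRallis1994, §1 Thm. 1.1] -/
theorem resNorm_scalar_mul (P : Finset ℂ) (E : ℂ → HA L e dV hdV dW hdW → ℂ) (a : ℂ → ℂ) :
    resNorm P (fun s h => a s * E s h) = fun h => a (1 / 2) * resNorm P E h := by
  funext h
  by_cases hP : (1 / 2 : ℂ) ∈ P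
  · rw [resNorm_of_mem hP, resNorm_of_mem hP, mul_div_assoc]
  · rw [resNorm_of_not_mem hP, resNorm_of_not_mem hP, mul_zero]

include hdV0 hdW0 in
/-- **THE RESIDUE FORM OF THE COMBINED PACKAGE**: `resNorm (P₁ ∪ P₂) E′ = resNorm P₁ E₁ + a(½)·resNorm P₂ E₂` (★ U0.4 `resNorm_add` applied to
`f′ = f₁ + (a·f₂)` with the packages `(P₁ ∪ P₂, E′)`, `(P₁, E₁)`, `(P₂, a·E₂)`, then `resNorm_scalar_mul`).  At `a(s) = 2(s − ½)` the second term VANISHES —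
the sheet's `resNorm_halfShift_smul_eq_zero`. [cite: KudlaRallis1994, §1 Thm. 1.1] [cite: Liu2021, Lem. B.12 pp. 103–104] -/
theorem resNorm_continuation_add_mul (hχ : χ.IsUnitary) (ha : Differentiable ℂ a)
    (hf₁ : ∀ s, IsSiegelDeltaSection L e dV hdV dW hdW χ s (f₁ s)) (hf₁c : ∀ s, Continuous (f₁ s))
    (hf₂ : ∀ s, IsSiegelDeltaSection L e dV hdV dW hdW χ s (f₂ s)) (hf₂c : ∀ s, Continuous (f₂ s))
    (hd₁ : ∀ h : HA L e dV hdV dW hdW, DifferentiableOn ℂ (fun s => E₁ s h) {s : ℂ | 0 < s.re})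
    (hiv₁ : ∀ (s : ℂ) (h : HA L e dV hdV dW hdW), (n : ℝ) / 2 < s.re →
      E₁ s h = (∏ p ∈ P₁, (s - p)) * eisensteinFamilyDelta L e dV hdV dW hdW f₁ s h)
    (hd₂ : ∀ h : HA L e dV hdV dW hdW, DifferentiableOn ℂ (fun s => E₂ s h) {s : ℂ | 0 < s.re})
    (hiv₂ : ∀ (s : ℂ) (h : HA L e dV hdV dW hdW), (n : ℝ) / 2 < s.re →
      E₂ s h = (∏ p ∈ P₂, (s - p)) * eisensteinFamilyDelta L e dV hdV dW hdW f₂ s h) :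
    resNorm (P₁ ∪ P₂) (fun s h => (∏ p ∈ P₂ \ P₁, (s - p)) * E₁ s h + a s * (∏ p ∈ P₁ \ P₂, (s - p)) * E₂ s h) =
      fun h => resNorm P₁ E₁ h + a (1 / 2) * resNorm P₂ E₂ h := by
  -- the second family `g₂ = a • f₂` and its package `(P₂, a·E₂)`
  have hg₂ : ∀ s, IsSiegelDeltaSection L e dV hdV dW hdW χ s ((fun s => a s • f₂ s) s) := fun s => (hf₂ s).smul (a s)
  have hg₂c : ∀ s, Continuous ((fun s => a s • f₂ s) s) := fun s => (hf₂c s).const_smul (a s)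
  have hf' : (fun s h => f₁ s h + a s * f₂ s h) = f₁ + fun s => a s • f₂ s := by
    funext s h
    simp only [Pi.add_apply, Pi.smul_apply, smul_eq_mul]
  have hd₂' : ∀ h : HA L e dV hdV dW hdW, DifferentiableOn ℂ (fun s => a s * E₂ s h) {s : ℂ | 0 < s.re} := fun h =>
    ha.differentiableOn.mul (hd₂ h)
  have hiv₂' : ∀ (s : ℂ) (h : HA L e dV hdV dW hdW), (n : ℝ) / 2 < s.re →
      a s * E₂ s h = (∏ p ∈ P₂, (s - p)) * eisensteinFamilyDelta L e dV hdV dW hdW (fun s => a s • f₂ s) s h := by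
    intro s h hs
    have hsm : eisensteinFamilyDelta L e dV hdV dW hdW (fun s => a s • f₂ s) s h = a s * eisensteinFamilyDelta L e dV hdV dW hdW f₂ s h := by
      simp only [eisensteinFamilyDelta]
      rw [show (a s • f₂ s) = fun x => a s * f₂ s x from funext fun x => by simp only [Pi.smul_apply, smul_eq_mul]]
      exact eisensteinSeriesDelta_const_mul L e dV hdV dW hdW (a s) (f₂ s) h
    rw [hsm, hiv₂ s h hs]
    ring
  have key := resNorm_add L e dV hdV hdV0 dW hdW hdW0 χ hχ f₁ (fun s => a s • f₂ s) hf₁ hf₁c hg₂ hg₂c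
    (fun s h => f₁ s h + a s * f₂ s h) hf' (P₁ ∪ P₂)
    (fun s h => (∏ p ∈ P₂ \ P₁, (s - p)) * E₁ s h + a s * (∏ p ∈ P₁ \ P₂, (s - p)) * E₂ s h)
    (continuation_add_mul_differentiableOn L e dV hdV dW hdW ha hd₁ hd₂)
    (fun s h hs => continuation_add_mul_eq L e dV hdV hdV0 dW hdW hdW0 hχ hf₁ hf₁c hf₂ hf₂c hiv₁ hiv₂ s h hs)
    P₁ E₁ hd₁ hiv₁ P₂ (fun s h => a s * E₂ s h) hd₂' hiv₂'
  rw [key, resNorm_scalar_mul L e dV hdV dW hdW P₂ E₂ a]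

end Packages

end Frame

end Summit.HodgeConjecture.HodgeConjecture.Cruxes.HLiu418.K2LiuContinuationPackageAlgebra

end
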